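import Mathlib
import Literature.Analysis.Complex.HolomorphicParametricIntegral
import Literature.MathematicalPhysics.QuantumFieldTheory.OSReconstructionNoE1Proofs

/-!
# The complex-time form `⟪ψ, e^{−τH} ψ'⟫` of an `OSReconstructionNoE1` — sharp, sesquilinear, holomorphic

drefute gen 4 (refuter-drefute-stmt-QuantumFields-9664-g4-0), support for `stub_coneChain_dense` (crux
`PlanarSpectralCone`): the inner-gap SLOTS of the density route are matrix elements `⟪Ψ_N, e^{−τH} Ψ_P⟫` at
complex `τ`, and `IsSectorData.slot_cont` / `slot_bound` need them CONTINUOUS (indeed sesquilinear and bounded by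
`‖Ψ_N‖ ‖Ψ_P‖`) in the vectors — which the landed `stub_complexTimeSlot` (bound `‖ψ‖² + ‖ψ'‖²`, no linearity) does
not give. Without an unbounded functional calculus:

* `exists_complexTimeMatrixElement`: for every `ψ, ψ'` a function holomorphic on `Re τ > 0`, equal to
  `⟪ψ, e^{-tH}ψ'⟫` at `t > 0`, bounded by `‖ψ‖ ‖ψ'‖` (ONE Kolmogorov isometry into `L²(μ_{ψ'})`: first
  isomorphism theorem + Hahn–Banach + Riesz, as in `OSHolomorphicVectors.exists_gramVec`; then a dominated
  holomorphic parameter integral);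
* `complexTimeForm h τ ψ ψ'` (a `def` by choice) with: holomorphy, real points, the sharp bound, UNIQUENESS
  (`complexTimeForm_eq`: any holomorphic function with the right real points is it), sesquilinearity
  (`_add_left/_right`, `_smul_left/_right`), hermitian symmetry, the semigroup shift
  `complexTimeForm h τ ψ (e^{-sH}ψ') = complexTimeForm h (τ+s) ψ ψ'`, and joint continuity in `(ψ, ψ')`.
-/

noncomputable section

namespace DrefuteG4

open MeasureTheory Complex Set Filter Topology
open scoped InnerProductSpace ComplexConjugate NNReal ENNReal
open Literature.MathematicalPhysics.AQFT Literature.MathematicalPhysics.QuantumFieldTheory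

section Kernel

variable {d : ℕ} [NeZero d]

theorem norm_tKernel (τ : ℂ) (p : EuclideanSpace ℝ (Fin d)) :
    ‖cexp (-(τ * ((p 0 : ℝ) : ℂ)))‖ = Real.exp (-(τ.re * p 0)) := by
  rw [Complex.norm_exp]
  congr 1
  simp

theorem norm_tKernel_le_one {τ : ℂ} (hτ : 0 ≤ τ.re) {p : EuclideanSpace ℝ (Fin d)} (hp : 0 ≤ p 0) :
    ‖cexp (-(τ * ((p 0 : ℝ) : ℂ)))‖ ≤ 1 := by
  rw [norm_tKernel, Real.exp_le_one_iff, neg_nonpos]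
  exact mul_nonneg hτ hp

theorem norm_rtKernel_le_one {t : ℝ} (ht : 0 ≤ t) {p : EuclideanSpace ℝ (Fin d)} (hp : 0 ≤ p 0) :
    ‖cexp (((-(t * p 0) : ℝ) : ℂ))‖ ≤ 1 := by
  rw [Complex.norm_exp, Real.exp_le_one_iff, Complex.ofReal_re, neg_nonpos]
  exact mul_nonneg ht hp

theorem conj_rtKernel_mul_rtKernel (t t' : ℝ) (p : EuclideanSpace ℝ (Fin d)) :
    conj (cexp (((-(t * p 0) : ℝ) : ℂ))) * cexp (((-(t' * p 0) : ℝ) : ℂ)) =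
      cexp (((-((t + t') * p 0) : ℝ) : ℂ)) := by
  rw [← Complex.exp_conj, ← Complex.exp_add, Complex.conj_ofReal]
  congr 1
  push_cast
  ring

theorem tKernel_ofReal (t : ℝ) (p : EuclideanSpace ℝ (Fin d)) :
    cexp (-((t : ℂ) * ((p 0 : ℝ) : ℂ))) = cexp (((-(t * p 0) : ℝ) : ℂ)) := by
  congr 1
  push_cast
  ring

theorem re_pos_of_mem_ball' {τ₀ τ : ℂ} (hτ : τ ∈ Metric.ball τ₀ τ₀.re) : 0 < τ.re := by
  rw [Metric.mem_ball, dist_eq_norm] at hτ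
  have h1 := abs_re_le_norm (τ - τ₀)
  rw [Complex.sub_re] at h1
  have h2 := (abs_lt.1 (h1.trans_lt hτ)).1
  linarith

theorem sum_sum_conj_mul_inner'' {H : Type*} [NormedAddCommGroup H] [InnerProductSpace ℂ H]
    {κ : Type*} (s : Finset κ) (c : κ → ℂ) (u : κ → H) :
    ∑ a ∈ s, ∑ b ∈ s, conj (c a) * c b * ⟪u a, u b⟫_ℂ =
      ⟪∑ a ∈ s, c a • u a, ∑ a ∈ s, c a • u a⟫_ℂ := by
  simp_rw [sum_inner, inner_sum, inner_smul_left, inner_smul_right]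
  refine Finset.sum_congr rfl fun a _ => Finset.sum_congr rfl fun b _ => by ring

/-- Identity theorem on the right half-plane from the real points beyond `c ≥ 0`. -/
theorem eqOn_halfPlane_of_eqOn_real {f g : ℂ → ℂ} (hf : DifferentiableOn ℂ f {τ : ℂ | 0 < τ.re})
    (hg : DifferentiableOn ℂ g {τ : ℂ | 0 < τ.re}) {c : ℝ} (hc : 0 ≤ c)
    (hreal : ∀ t : ℝ, c < t → f t = g t) : EqOn f g {τ : ℂ | 0 < τ.re} := by
  have hU : IsOpen {τ : ℂ | 0 < τ.re} := isOpen_lt continuous_const Complex.continuous_re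
  have hUc : IsPreconnected {τ : ℂ | 0 < τ.re} := (convex_halfSpace_re_gt 0).isPreconnected
  have hfa : AnalyticOnNhd ℂ f {τ : ℂ | 0 < τ.re} := hf.analyticOnNhd hU
  have hga : AnalyticOnNhd ℂ g {τ : ℂ | 0 < τ.re} := hg.analyticOnNhd hU
  have hz₀ : (((c + 1 : ℝ)) : ℂ) ∈ {τ : ℂ | 0 < τ.re} := by
    simp only [Set.mem_setOf_eq, Complex.ofReal_re]; linarith
  have hfreq : ∃ᶠ w in 𝓝[≠] (((c + 1 : ℝ)) : ℂ), f w = g w := by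
    set u : ℕ → ℂ := fun n => (((c + 1 + 1 / ((n : ℝ) + 1) : ℝ)) : ℂ) with hu
    have hut : Tendsto u atTop (𝓝[≠] (((c + 1 : ℝ)) : ℂ)) := by
      rw [tendsto_nhdsWithin_iff]
      refine ⟨?_, Eventually.of_forall fun n => ?_⟩
      · have h1 : Tendsto (fun n : ℕ => c + 1 + 1 / ((n : ℝ) + 1)) atTop (𝓝 (c + 1 + 0)) :=
          (tendsto_const_nhds (x := c + 1) (f := (atTop : Filter ℕ))).add
            tendsto_one_div_add_atTop_nhds_zero_nat
        rw [add_zero] at h1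
        exact (Complex.continuous_ofReal.tendsto (c + 1)).comp h1
      · simp only [hu, Set.mem_compl_iff, Set.mem_singleton_iff, Complex.ofReal_inj]
        have : 0 < 1 / ((n : ℝ) + 1) := by positivity
        linarith
    have hall : ∀ n, f (u n) = g (u n) := fun n => by
      have : 0 < 1 / ((n : ℝ) + 1) := by positivity
      exact hreal _ (by linarith)
    exact hut.frequently (Frequently.of_forall hall)
  exact hfa.eqOn_of_preconnected_of_frequently_eq hga hUc hz₀ hfreq

end Kernel

section OS

variable {ι : Type*} {d : ℕ} [NeZero d] {S : LabelledSchwingerFamily ι (EuclideanSpace ℝ (Fin d))}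
  (h : OSReconstructionNoE1 S)

/-- `⟪e^{-tH}ψ', e^{-t'H}ψ'⟫ = ∫ e^{−(t+t')p₀} dμ_{ψ'}`. -/
theorem inner_transfer_transfer {ψ' : h.Hilbert} {μ' : Measure (EuclideanSpace ℝ (Fin d))}
    (hμ' : h.IsJointSpectralMeasure ψ' μ') {t t' : ℝ} (ht : 0 ≤ t) (ht' : 0 ≤ t') :
    ⟪h.transfer t ψ', h.transfer t' ψ'⟫_ℂ = ∫ p, cexp (((-((t + t') * p 0) : ℝ) : ℂ)) ∂μ' := by
  rw [h.inner_transfer_left, ← ContinuousLinearMap.comp_apply, ← h.transfer_add ht ht',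
    hμ'.inner_transfer h (add_nonneg ht ht')]

/-- **The complex-time matrix element, sharp form.** For any `ψ, ψ'` there is `φ` holomorphic on
`Re τ > 0` with `φ t = ⟪ψ, e^{-tH}ψ'⟫` (`t > 0`) and `|φ τ| ≤ ‖ψ‖ ‖ψ'‖`. -/
theorem exists_complexTimeMatrixElement (ψ ψ' : h.Hilbert) :
    ∃ φ : ℂ → ℂ, DifferentiableOn ℂ φ {τ : ℂ | 0 < τ.re} ∧
      (∀ t : ℝ, 0 < t → φ t = ⟪ψ, h.transfer t ψ'⟫_ℂ) ∧
      ∀ τ : ℂ, 0 < τ.re → ‖φ τ‖ ≤ ‖ψ‖ * ‖ψ'‖ := by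
  classical
  obtain ⟨μ', hμ'⟩ := OSReconstructionNoE1.exists_isJointSpectralMeasure_holds h ψ'
  haveI := hμ'.isFiniteMeasure
  have hae0 : ∀ᵐ p ∂μ', (0 : ℝ) ≤ p 0 := by
    rw [ae_iff]; simpa only [not_le] using hμ'.energy_nonneg
  -- real points `t ≥ 0`: kernels `e^{−tp₀} ∈ L²(μ')` and vectors `e^{-tH}ψ'`
  let R : Type := {t : ℝ // 0 ≤ t}
  let e : R → EuclideanSpace ℝ (Fin d) → ℂ := fun r p => cexp (((-(r.1 * p 0) : ℝ) : ℂ))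
  have he : ∀ r : R, MemLp (e r) 2 μ' := fun r =>
    MemLp.of_bound (by fun_prop : Continuous (e r)).aestronglyMeasurable 1
      (by filter_upwards [hae0] with p hp using norm_rtKernel_le_one r.2 hp)
  let E : R → Lp ℂ 2 μ' := fun r => (he r).toLp (e r)
  have hE : ∀ r : R, (E r : EuclideanSpace ℝ (Fin d) → ℂ) =ᵐ[μ'] e r := fun r => (he r).coeFn_toLp
  let V : R → h.Hilbert := fun r => h.transfer r.1 ψ'
  have hgram : ∀ r s : R, ⟪E r, E s⟫_ℂ = ⟪V r, V s⟫_ℂ := by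
    intro r s
    rw [MeasureTheory.L2.inner_def, inner_transfer_transfer h hμ' r.2 s.2]
    refine integral_congr_ae ?_
    filter_upwards [hE r, hE s] with p hr hs
    rw [hr, hs, RCLike.inner_apply, mul_comm]
    exact conj_rtKernel_mul_rtKernel r.1 s.1 p
  set ΛE : (R →₀ ℂ) →ₗ[ℂ] Lp ℂ 2 μ' := Finsupp.linearCombination ℂ E with hΛE
  set ΛV : (R →₀ ℂ) →ₗ[ℂ] h.Hilbert := Finsupp.linearCombination ℂ V with hΛV
  have hnorm : ∀ l, ‖ΛV l‖ = ‖ΛE l‖ := by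
    intro l
    have hV' : ΛV l = ∑ a ∈ l.support, l a • V a := by
      rw [hΛV, Finsupp.linearCombination_apply, Finsupp.sum]
    have hE' : ΛE l = ∑ a ∈ l.support, l a • E a := by
      rw [hΛE, Finsupp.linearCombination_apply, Finsupp.sum]
    have hinner : ⟪ΛV l, ΛV l⟫_ℂ = ⟪ΛE l, ΛE l⟫_ℂ := by
      rw [hV', hE', ← sum_sum_conj_mul_inner'', ← sum_sum_conj_mul_inner'']
      simp_rw [hgram]
    have h1 := inner_self_eq_norm_sq (𝕜 := ℂ) (ΛV l)
    have h2 := inner_self_eq_norm_sq (𝕜 := ℂ) (ΛE l)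
    rw [hinner] at h1
    have h3 : ‖ΛV l‖ ^ 2 = ‖ΛE l‖ ^ 2 := by rw [← h1, ← h2]
    exact (pow_left_inj₀ (norm_nonneg _) (norm_nonneg _) two_ne_zero).1 h3
  set L : (R →₀ ℂ) →ₗ[ℂ] ℂ := (innerSL ℂ ψ : h.Hilbert →L[ℂ] ℂ).toLinearMap ∘ₗ ΛV with hL
  have hLapply : ∀ l, L l = ⟪ψ, ΛV l⟫_ℂ := fun l => rfl
  have hbound : ∀ l, ‖L l‖ ≤ ‖ψ‖ * ‖ΛE l‖ := by
    intro l
    rw [hLapply, ← hnorm]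
    exact norm_inner_le_norm _ _
  have hker : LinearMap.ker ΛE ≤ LinearMap.ker L := fun l hl => by
    rw [LinearMap.mem_ker] at hl ⊢
    have := hbound l
    rw [hl, norm_zero, mul_zero] at this
    exact norm_le_zero_iff.1 this
  set L' : LinearMap.range ΛE →ₗ[ℂ] ℂ :=
    ((LinearMap.ker ΛE).liftQ L hker).comp ΛE.quotKerEquivRange.symm.toLinearMap with hL'
  have hL'apply : ∀ l, L' ⟨ΛE l, LinearMap.mem_range_self ΛE l⟩ = L l := by
    intro l
    have hq : ΛE.quotKerEquivRange.symm ⟨ΛE l, LinearMap.mem_range_self ΛE l⟩ =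
        Submodule.Quotient.mk l := by
      rw [LinearEquiv.symm_apply_eq]
      apply Subtype.ext
      rw [LinearMap.quotKerEquivRange_apply_mk]
    simp only [hL', LinearMap.comp_apply, LinearEquiv.coe_toLinearMap, hq, Submodule.liftQ_apply]
  have hL'bound : ∀ v : LinearMap.range ΛE, ‖L' v‖ ≤ ‖ψ‖ * ‖v‖ := by
    rintro ⟨v, hv⟩
    obtain ⟨l, rfl⟩ := LinearMap.mem_range.1 hv
    rw [hL'apply l]
    exact hbound l
  set L'c : LinearMap.range ΛE →L[ℂ] ℂ := L'.mkContinuous ‖ψ‖ hL'bound with hL'c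
  have hL'c_norm : ‖L'c‖ ≤ ‖ψ‖ := LinearMap.mkContinuous_norm_le _ (norm_nonneg _) _
  obtain ⟨gext, hgext, hgext_norm⟩ := exists_extension_norm_eq (LinearMap.range ΛE) L'c
  set g : Lp ℂ 2 μ' := (InnerProductSpace.toDual ℂ (Lp ℂ 2 μ')).symm gext with hg
  have hg_inner : ∀ v, ⟪g, v⟫_ℂ = gext v := fun v => InnerProductSpace.toDual_symm_apply
  have hg_norm : ‖g‖ ≤ ‖ψ‖ := by
    rw [hg, LinearIsometryEquiv.norm_map, hgext_norm]; exact hL'c_norm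
  have hgE : ∀ r : R, ⟪g, E r⟫_ℂ = ⟪ψ, V r⟫_ℂ := by
    intro r
    have hΛ1 : ΛE (Finsupp.single r 1) = E r := by
      rw [hΛE, Finsupp.linearCombination_single, one_smul]
    have hΛV1 : ΛV (Finsupp.single r 1) = V r := by
      rw [hΛV, Finsupp.linearCombination_single, one_smul]
    calc ⟪g, E r⟫_ℂ = gext (E r) := hg_inner _
      _ = gext (ΛE (Finsupp.single r 1)) := by rw [hΛ1]
      _ = L'c ⟨ΛE (Finsupp.single r 1), LinearMap.mem_range_self ΛE _⟩ :=
          hgext ⟨ΛE (Finsupp.single r 1), LinearMap.mem_range_self ΛE _⟩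
      _ = L (Finsupp.single r 1) := by rw [hL'c, LinearMap.mkContinuous_apply, hL'apply]
      _ = ⟪ψ, V r⟫_ℂ := by rw [hLapply, hΛV1]
  have hg_int : Integrable (fun p => (g : EuclideanSpace ℝ (Fin d) → ℂ) p) μ' :=
    (Lp.memLp g).integrable one_le_two
  refine ⟨fun τ => ∫ p, conj ((g : EuclideanSpace ℝ (Fin d) → ℂ) p) * cexp (-(τ * ((p 0 : ℝ) : ℂ))) ∂μ',
    ?_, ?_, ?_⟩
  · refine Literature.Analysis.Complex.differentiableOn_integral_of_dominated
      (fun τ _ => ((Lp.aestronglyMeasurable g).star.mul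
        (by fun_prop : Continuous fun p : EuclideanSpace ℝ (Fin d) =>
          cexp (-(τ * ((p 0 : ℝ) : ℂ)))).aestronglyMeasurable))
      (Eventually.of_forall fun p => (by fun_prop : Differentiable ℂ fun τ : ℂ =>
        conj ((g : EuclideanSpace ℝ (Fin d) → ℂ) p) * cexp (-(τ * ((p 0 : ℝ) : ℂ)))).differentiableOn)
      fun τ₀ hτ₀ => ?_
    refine ⟨τ₀.re, hτ₀, fun τ hτ => re_pos_of_mem_ball' hτ, fun p => ‖(g : EuclideanSpace ℝ (Fin d) → ℂ) p‖,
      hg_int.norm, ?_⟩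
    filter_upwards [hae0] with p hp
    intro τ hτ
    rw [norm_mul, RCLike.norm_conj]
    calc ‖(g : EuclideanSpace ℝ (Fin d) → ℂ) p‖ * ‖cexp (-(τ * ((p 0 : ℝ) : ℂ)))‖
        ≤ ‖(g : EuclideanSpace ℝ (Fin d) → ℂ) p‖ * 1 := by
          gcongr; exact norm_tKernel_le_one (re_pos_of_mem_ball' hτ).le hp
      _ = ‖(g : EuclideanSpace ℝ (Fin d) → ℂ) p‖ := mul_one _
  · intro t ht
    let r : R := ⟨t, ht.le⟩
    have h1 : (∫ p, conj ((g : EuclideanSpace ℝ (Fin d) → ℂ) p) * cexp (-((t : ℂ) * ((p 0 : ℝ) : ℂ))) ∂μ') =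
        ⟪g, E r⟫_ℂ := by
      rw [MeasureTheory.L2.inner_def]
      refine integral_congr_ae ?_
      filter_upwards [hE r] with p hp
      rw [hp, RCLike.inner_apply, tKernel_ofReal]
      exact mul_comm _ _
    show (∫ p, conj ((g : EuclideanSpace ℝ (Fin d) → ℂ) p) * cexp (-((t : ℂ) * ((p 0 : ℝ) : ℂ))) ∂μ') = _
    rw [h1, hgE r]
  · intro τ hτ
    have hF : MemLp (fun p : EuclideanSpace ℝ (Fin d) => cexp (-(τ * ((p 0 : ℝ) : ℂ)))) 2 μ' :=
      MemLp.of_bound (by fun_prop : Continuous fun p : EuclideanSpace ℝ (Fin d) =>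
        cexp (-(τ * ((p 0 : ℝ) : ℂ)))).aestronglyMeasurable 1
        (by filter_upwards [hae0] with p hp using norm_tKernel_le_one hτ.le hp)
    set F : Lp ℂ 2 μ' := hF.toLp _ with hF_def
    have hF_ae : (F : EuclideanSpace ℝ (Fin d) → ℂ) =ᵐ[μ'] fun p => cexp (-(τ * ((p 0 : ℝ) : ℂ))) :=
      hF.coeFn_toLp
    have h1 : (∫ p, conj ((g : EuclideanSpace ℝ (Fin d) → ℂ) p) * cexp (-(τ * ((p 0 : ℝ) : ℂ))) ∂μ') =
        ⟪g, F⟫_ℂ := by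
      rw [MeasureTheory.L2.inner_def]
      refine integral_congr_ae ?_
      filter_upwards [hF_ae] with p hp
      rw [hp, RCLike.inner_apply, mul_comm]
    have hF_norm : ‖F‖ ≤ ‖ψ'‖ := by
      have hb := Lp.norm_le_of_ae_bound (f := F) zero_le_one
        (by filter_upwards [hF_ae, hae0] with p hp hp'
            rw [hp]; exact norm_tKernel_le_one hτ.le hp')
      have hm : (measureUnivNNReal μ' : ℝ) = ‖ψ'‖ ^ 2 := by
        rw [← hμ'.measureReal_univ, measureReal_def]
        rfl
      rw [mul_one] at hb
      refine hb.trans (le_of_eq ?_)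
      rw [hm]
      have : ((2 : ℝ≥0∞).toReal)⁻¹ = ((2 : ℕ) : ℝ)⁻¹ := by norm_num
      rw [this, Real.pow_rpow_inv_natCast (norm_nonneg _) two_ne_zero]
    show ‖∫ p, conj ((g : EuclideanSpace ℝ (Fin d) → ℂ) p) * cexp (-(τ * ((p 0 : ℝ) : ℂ))) ∂μ'‖ ≤ ‖ψ‖ * ‖ψ'‖
    rw [h1]
    calc ‖⟪g, F⟫_ℂ‖ ≤ ‖g‖ * ‖F‖ := norm_inner_le_norm _ _
      _ ≤ ‖ψ‖ * ‖ψ'‖ := by gcongr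

/-- **The complex-time form** `B_τ(ψ, ψ') = "⟪ψ, e^{−τH} ψ'⟫"`, `Re τ > 0` (a choice of the function of
`exists_complexTimeMatrixElement`; canonical by `complexTimeForm_eq`). -/
def complexTimeForm (τ : ℂ) (ψ ψ' : h.Hilbert) : ℂ :=
  Classical.choose (exists_complexTimeMatrixElement h ψ ψ') τ

theorem differentiableOn_complexTimeForm (ψ ψ' : h.Hilbert) :
    DifferentiableOn ℂ (fun τ => complexTimeForm h τ ψ ψ') {τ : ℂ | 0 < τ.re} :=
  (Classical.choose_spec (exists_complexTimeMatrixElement h ψ ψ')).1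

theorem complexTimeForm_ofReal {t : ℝ} (ht : 0 < t) (ψ ψ' : h.Hilbert) :
    complexTimeForm h t ψ ψ' = ⟪ψ, h.transfer t ψ'⟫_ℂ :=
  (Classical.choose_spec (exists_complexTimeMatrixElement h ψ ψ')).2.1 t ht

theorem norm_complexTimeForm_le {τ : ℂ} (hτ : 0 < τ.re) (ψ ψ' : h.Hilbert) :
    ‖complexTimeForm h τ ψ ψ'‖ ≤ ‖ψ‖ * ‖ψ'‖ :=
  (Classical.choose_spec (exists_complexTimeMatrixElement h ψ ψ')).2.2 τ hτ

/-- **Uniqueness**: a function holomorphic on `Re τ > 0` with the real points `⟪ψ, e^{-tH}ψ'⟫` beyond some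
`c ≥ 0` IS the complex-time form. -/
theorem complexTimeForm_eq {φ : ℂ → ℂ} (hφ : DifferentiableOn ℂ φ {τ : ℂ | 0 < τ.re}) {ψ ψ' : h.Hilbert}
    {c : ℝ} (hc : 0 ≤ c) (hreal : ∀ t : ℝ, c < t → φ t = ⟪ψ, h.transfer t ψ'⟫_ℂ) {τ : ℂ} (hτ : 0 < τ.re) :
    φ τ = complexTimeForm h τ ψ ψ' :=
  eqOn_halfPlane_of_eqOn_real hφ (differentiableOn_complexTimeForm h ψ ψ') hc
    (fun t ht => by rw [hreal t ht, complexTimeForm_ofReal h (hc.trans_lt ht)]) hτ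

theorem complexTimeForm_add_left {τ : ℂ} (hτ : 0 < τ.re) (ψ₁ ψ₂ ψ' : h.Hilbert) :
    complexTimeForm h τ (ψ₁ + ψ₂) ψ' = complexTimeForm h τ ψ₁ ψ' + complexTimeForm h τ ψ₂ ψ' := by
  symm
  refine complexTimeForm_eq h (φ := fun τ => complexTimeForm h τ ψ₁ ψ' + complexTimeForm h τ ψ₂ ψ')
    ((differentiableOn_complexTimeForm h ψ₁ ψ').add (differentiableOn_complexTimeForm h ψ₂ ψ')) le_rfl
    (fun t ht => ?_) hτ
  simp only [complexTimeForm_ofReal h ht, inner_add_left]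

theorem complexTimeForm_add_right {τ : ℂ} (hτ : 0 < τ.re) (ψ ψ₁ ψ₂ : h.Hilbert) :
    complexTimeForm h τ ψ (ψ₁ + ψ₂) = complexTimeForm h τ ψ ψ₁ + complexTimeForm h τ ψ ψ₂ := by
  symm
  refine complexTimeForm_eq h (φ := fun τ => complexTimeForm h τ ψ ψ₁ + complexTimeForm h τ ψ ψ₂)
    ((differentiableOn_complexTimeForm h ψ ψ₁).add (differentiableOn_complexTimeForm h ψ ψ₂)) le_rfl
    (fun t ht => ?_) hτ
  simp only [complexTimeForm_ofReal h ht, map_add, inner_add_right]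

theorem complexTimeForm_smul_left {τ : ℂ} (hτ : 0 < τ.re) (c : ℂ) (ψ ψ' : h.Hilbert) :
    complexTimeForm h τ (c • ψ) ψ' = conj c * complexTimeForm h τ ψ ψ' := by
  symm
  refine complexTimeForm_eq h (φ := fun τ => conj c * complexTimeForm h τ ψ ψ')
    ((differentiableOn_complexTimeForm h ψ ψ').const_mul _) le_rfl (fun t ht => ?_) hτ
  simp only [complexTimeForm_ofReal h ht, inner_smul_left]

theorem complexTimeForm_smul_right {τ : ℂ} (hτ : 0 < τ.re) (c : ℂ) (ψ ψ' : h.Hilbert) :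
    complexTimeForm h τ ψ (c • ψ') = c * complexTimeForm h τ ψ ψ' := by
  symm
  refine complexTimeForm_eq h (φ := fun τ => c * complexTimeForm h τ ψ ψ')
    ((differentiableOn_complexTimeForm h ψ ψ').const_mul _) le_rfl (fun t ht => ?_) hτ
  simp only [complexTimeForm_ofReal h ht, map_smul, inner_smul_right]

theorem complexTimeForm_sub_left {τ : ℂ} (hτ : 0 < τ.re) (ψ₁ ψ₂ ψ' : h.Hilbert) :
    complexTimeForm h τ (ψ₁ - ψ₂) ψ' = complexTimeForm h τ ψ₁ ψ' - complexTimeForm h τ ψ₂ ψ' := by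
  rw [sub_eq_add_neg, complexTimeForm_add_left h hτ, ← neg_one_smul ℂ ψ₂, complexTimeForm_smul_left h hτ]
  simp [sub_eq_add_neg]

theorem complexTimeForm_sub_right {τ : ℂ} (hτ : 0 < τ.re) (ψ ψ₁ ψ₂ : h.Hilbert) :
    complexTimeForm h τ ψ (ψ₁ - ψ₂) = complexTimeForm h τ ψ ψ₁ - complexTimeForm h τ ψ ψ₂ := by
  rw [sub_eq_add_neg, complexTimeForm_add_right h hτ, ← neg_one_smul ℂ ψ₂, complexTimeForm_smul_right h hτ]
  simp [sub_eq_add_neg]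

/-- **Hermitian symmetry**: `conj B_τ(ψ, ψ') = B_{τ̄}(ψ', ψ)`. -/
theorem conj_complexTimeForm {τ : ℂ} (hτ : 0 < τ.re) (ψ ψ' : h.Hilbert) :
    conj (complexTimeForm h τ ψ ψ') = complexTimeForm h (conj τ) ψ' ψ := by
  -- `τ ↦ conj (B_{conj τ}(ψ', ψ))` is holomorphic with the real points `⟪ψ, e^{-tH}ψ'⟫`
  have hd : DifferentiableOn ℂ (fun τ => conj (complexTimeForm h (conj τ) ψ' ψ)) {τ : ℂ | 0 < τ.re} := by
    intro τ₀ hτ₀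
    have hU : IsOpen {τ : ℂ | 0 < τ.re} := isOpen_lt continuous_const Complex.continuous_re
    have hmem : conj τ₀ ∈ {τ : ℂ | 0 < τ.re} := by simpa using hτ₀
    have h1 : DifferentiableAt ℂ (fun τ => complexTimeForm h τ ψ' ψ) (conj τ₀) :=
      (differentiableOn_complexTimeForm h ψ' ψ).differentiableAt (hU.mem_nhds hmem)
    have h2 : DifferentiableAt ℂ (fun τ => conj (complexTimeForm h (conj τ) ψ' ψ)) τ₀ := by
      have h3 := (h1.hasDerivAt.conj_conj).differentiableAt
      rw [Complex.conj_conj] at h3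
      exact h3
    exact h2.differentiableWithinAt
  have key := complexTimeForm_eq h hd (ψ := ψ) (ψ' := ψ') le_rfl (fun t ht => by
    show conj (complexTimeForm h (conj (t : ℂ)) ψ' ψ) = _
    rw [Complex.conj_ofReal, complexTimeForm_ofReal h ht, ← h.inner_transfer_left, inner_conj_symm]) hτ
  -- read `key` at `τ`, then conjugate
  have := congrArg conj key
  simpa using this.symm

/-- **Semigroup shift in the second slot**: `B_τ(ψ, e^{-sH}ψ') = B_{τ+s}(ψ, ψ')` (`s ≥ 0`). -/
theorem complexTimeForm_transfer_right {τ : ℂ} (hτ : 0 < τ.re) {s : ℝ} (hs : 0 ≤ s) (ψ ψ' : h.Hilbert) :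
    complexTimeForm h τ ψ (h.transfer s ψ') = complexTimeForm h (τ + s) ψ ψ' := by
  have hd : DifferentiableOn ℂ (fun τ => complexTimeForm h (τ + s) ψ ψ') {τ : ℂ | 0 < τ.re} := by
    intro τ₀ hτ₀
    have hU : IsOpen {τ : ℂ | 0 < τ.re} := isOpen_lt continuous_const Complex.continuous_re
    have hmem : τ₀ + s ∈ {τ : ℂ | 0 < τ.re} := by
      simp only [Set.mem_setOf_eq, Complex.add_re, Complex.ofReal_re] at hτ₀ ⊢; linarith
    have h1 : DifferentiableAt ℂ (fun τ => complexTimeForm h τ ψ ψ') (τ₀ + s) :=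
      (differentiableOn_complexTimeForm h ψ ψ').differentiableAt (hU.mem_nhds hmem)
    exact (h1.comp τ₀ (differentiableAt_id.add_const _)).differentiableWithinAt
  symm
  refine complexTimeForm_eq h hd le_rfl (fun t ht => ?_) hτ
  show complexTimeForm h ((t : ℂ) + s) ψ ψ' = _
  have : ((t : ℂ) + (s : ℂ)) = ((t + s : ℝ) : ℂ) := by push_cast; rfl
  rw [this, complexTimeForm_ofReal h (by linarith), h.transfer_add ht.le hs, ContinuousLinearMap.comp_apply]

/-- Lipschitz-type estimate (sesquilinearity + the sharp bound). -/
theorem norm_complexTimeForm_sub_le {τ : ℂ} (hτ : 0 < τ.re) (ψ ψ' φ φ' : h.Hilbert) :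
    ‖complexTimeForm h τ ψ ψ' - complexTimeForm h τ φ φ'‖ ≤ ‖ψ - φ‖ * ‖ψ'‖ + ‖φ‖ * ‖ψ' - φ'‖ := by
  have e : complexTimeForm h τ ψ ψ' - complexTimeForm h τ φ φ' =
      complexTimeForm h τ (ψ - φ) ψ' + complexTimeForm h τ φ (ψ' - φ') := by
    rw [complexTimeForm_sub_left h hτ, complexTimeForm_sub_right h hτ]; ring
  rw [e]
  exact (norm_add_le _ _).trans (add_le_add (norm_complexTimeForm_le h hτ _ _) (norm_complexTimeForm_le h hτ _ _))

/-- **Joint continuity in the vectors** at fixed complex time. -/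
theorem continuous_complexTimeForm {τ : ℂ} (hτ : 0 < τ.re) :
    Continuous fun x : h.Hilbert × h.Hilbert => complexTimeForm h τ x.1 x.2 := by
  refine continuous_iff_continuousAt.2 fun x₀ => ?_
  rw [ContinuousAt, tendsto_iff_norm_sub_tendsto_zero]
  have hb : ∀ x : h.Hilbert × h.Hilbert, ‖complexTimeForm h τ x.1 x.2 - complexTimeForm h τ x₀.1 x₀.2‖ ≤
      ‖x.1 - x₀.1‖ * ‖x.2‖ + ‖x₀.1‖ * ‖x.2 - x₀.2‖ := fun x => norm_complexTimeForm_sub_le h hτ _ _ _ _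
  refine squeeze_zero (fun x => norm_nonneg _) hb ?_
  have hc : Continuous fun x : h.Hilbert × h.Hilbert => ‖x.1 - x₀.1‖ * ‖x.2‖ + ‖x₀.1‖ * ‖x.2 - x₀.2‖ := by
    fun_prop
  have := hc.tendsto x₀
  simpa using this

end OS

end DrefuteG4
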